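import Literature.MathematicalPhysics.QuantumFieldTheory.Balaban1983to89.B9SectCLatticeCarrier
import Literature.MathematicalPhysics.QuantumFieldTheory.Balaban1983to89.B8CurlGradHolonomy

/-!
# `Balaban1983to89.B9Eq33CovDerivVector` — T. Bałaban, *Propagators for lattice gauge theories in a background field*, Commun.
# Math. Phys. **99** (1985) 389–434 [Balaban1985BackgroundPropagators], (3.3) pp. 390–391: the COVARIANT DERIVATIVE
# `(D^η_{U₀}A)(b) = η⁻¹(R(U₀(b))A(b₊) − A(b₋))` FOR FIBRE-VALUED FUNCTIONS (𝔤ᶜ-valued, vector-valued) as a LINEAR MAP on the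
# periodic lattice of `B9SectCLatticeCarrier`, with the transporter `R(U₀(b))` a linear datum and `R(U)X = UXU⁻¹` (p. 390)
# supplied for configurations in the units of an algebra; the componentwise `∇_μ A_ν` of bond functions (p. 391) — the `∇`
# of the sizes `|∇·|_{(−2)}` of [Balaban1985Variational] (77)/(115); and the ADJOINT `D*` (3.8) p. 392 with its `ℓ²`-adjointness to `D`

statement-level skeleton of published theorems with citation tags; proofs where landed; nothing here is a claim
about the Yang–Mills mass gap

PDF held: `paper:balaban1985-cmp99-background-propagators` (journal page = PDF page + 388); pp. 390–391 (PDF 2–3) read from the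
held text by this seat (`lit read`, 2026-08-21).

THE PRINT (verbatim, pp. 390–391).  *«Let us recall that R(U)X = UXU⁻¹. … Let us introduce covariant derivatives. For a matrix
valued function A defined at points of the lattice we put (D^η_{U₀}A)(b) = η⁻¹(R(U₀(b))A(b₊) − A(b₋)), or (D^η_{U₀,μ}A)(x) =
(D^η_{U₀}A)(⟨x, x + ηe_μ⟩), μ = 1, …, d. (3.3) For a function A defined at bonds of the lattice we put (D^η_{U₀}A)(p) = … (3.4)
for a plaquette p = ⟨x, y, z, w⟩, and if p = p_{μν}(x) … then we have (D^η_{U₀}A)(p_{μν}(x)) = (D^η_{U₀}A)_{μν}(x) =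
(D^η_{U₀,μ}A_ν)(x) − (D^η_{U₀,ν}A_μ)(x). We have made here the identification A(x, x + ηe_μ) = A_μ(x).»*

WHY THIS FILE (cell context).  `B9SectCLatticeCarrier` types (3.3)/(3.4)/(3.8) on the periodic lattice `TSite d Pd = Π_i ℤ/P_iℤ`
in SCALAR READING — its honest caveat (1): *«the transporter R(U(b)) ∈ G ⊂ U(N) of (3.3)–(3.5) is replaced by a REAL bond field r
… The genuine matrix-valued tables fold the colour index into the carriers … this is not done here»*.  The sizes
`|∇A′|_{(−2)}` of [Balaban1985Variational] (77)/(115) (companion file `B11Eq115Space`, letter (L1) of lit-balaban `INTERFACES.md`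
§3 NEED-3) take `∇ = ∇^{U₀}` on 𝔤ᶜ-VALUED bond functions as a LINEAR MAP `(bonds → V) →ₗ (bonds × directions → V)`.  The tree also
holds the ABSTRACT one-direction action form `B8CurlGradHolonomy.covD s U f x = U x • f (s x) − f x` (η = 1, any monoid action, any
index type).  THIS FILE types the linear map (letter (L1′)): the fibre `V` any module, the transporter any family of linear maps of
`V` (§1–§2), the printed `R(U)X = UXU⁻¹` for unit-valued configurations in an algebra (§3), the adjoint `D*` (3.8) with its
`ℓ²`-adjointness to `D` (§4), and proves agreement with the THREE tree readings (`covDeriv_scalar`, `covDiv_scalar`,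
`covDeriv_eq_smul_B8covD`).

WHAT IS DEFINED AND PROVED (sorry-free; no `Prop` placeholder; no inequality).
* §1 `covDeriv c R : (TSite d Pd → V) →ₗ[𝕜] (Bond d Pd → V)` — (3.3) with weight `c` (= η⁻¹) and transporter `R : Bond → (V →ₗ V)`;
  `covDeriv_apply`, `covDeriv_apply_dir` (the `D_μ` form), `covDeriv_apply_flat` (`U₀ = 1`: forward difference),
  **`covDeriv_scalar`**: for `V = ℝ`, `R(b) = r(b)·id` it IS the tree's scalar (3.3) `(sT c r − sJ c)·f` (`B9SectCLatticeCarrier.sD_mulVec`),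
  and **`covDeriv_eq_smul_B8covD`**: for a monoid action `R(x, μ) = (U(x, μ) • ·)` it is `c • B8CurlGradHolonomy.covD (shift μ) …`.
* §2 `covGrad c R : (Bond d Pd → V) →ₗ[𝕜] (Bond d Pd × Fin d → V)` — `(∇A)((x,μ),ν) = (D_μ A_ν)(x)`, (3.3) on each component under the
  identification `A(x, x + ηe_μ) = A_μ(x)`; `covGrad_apply`, `covGrad_eq_covDeriv_comp`, `covGrad_apply_dir`.
* §3 `adTransport U b : 𝔸 →ₗ[𝕜] 𝔸`, `X ↦ U(b)XU(b)⁻¹` for `U : Bond → 𝔸ˣ` (`𝔸` a `𝕜`-algebra, e.g. `Matrix (Fin N) (Fin N) ℂ` with the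
  gauge group inside its units); `adTransport_apply`, `_one`, `_mul`, `_apply_one`; `covDeriv_adTransport_apply`,
  `covGrad_adTransport_apply` = (3.3) for 𝔤-valued functions verbatim.
* §4 `covDiv c S : (Bond d Pd → V) →ₗ[𝕜] (TSite d Pd → V)` — THE ADJOINT DERIVATIVE (3.8) p. 392 `(D*A)(x) = Σ_μ η⁻¹(R(U(x, x − ηe_μ))A(x −
  ηe_μ, x) − A(x, x + ηe_μ))` with the adjoint transporters `S(b) = R(U(b))⁻¹` a datum; `covDiv_scalar` (= the tree's
  `sD_transpose_mulVec`: for uniform weights the adjoint IS the transpose) and **`sum_inner_covDeriv_eq_sum_inner_covDiv`**: on the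
  periodic lattice, for real-inner-product fibres and mutually adjoint transporter data (`⟪w, R(b)v⟫ = ⟪S(b)w, v⟫`), `Σ_b ⟪A(b), (Df)(b)⟫ =
  Σ_x ⟪(D*A)(x), f(x)⟫` — p. 391 *«The adjoints are taken with respect to natural L² scalar products»*, PROVED (re-indexing along the
  permutation `shiftEquiv μ : x ↦ x + e_μ`).

MODEL / DECLARED READINGS.  (M1) LATTICE: the unit periodic lattice and bond conventions of `B9SectCLatticeCarrier` (bond
`(x, μ) = ⟨x, x + e_μ⟩`, `bpos`/`btgt`; positively oriented bonds only — the orientation convention (3.5) `A(x′, x) = −A(x, x′)`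
is not needed for (3.3) on components); `η`-scaling enters only through the weight `c`.  (M2) TRANSPORTER AS DATUM: `R` is any
family of linear maps; print's `R(U₀(b))` is `adTransport U₀ b` (§3) for the adjoint action on 𝔤ᶜ ⊆ 𝔸 — that 𝔤ᶜ is
`adTransport`-invariant for `U` in the gauge group is not needed to DEFINE the map on `𝔸`-valued functions and is not
asserted.  (M3) NO CURL: (3.4) (the plaquette derivative) is `B9SectCLatticeCarrier` §4's business; only the componentwise
`D_μA_ν` entering `|∇A|` is typed here.
HONEST SCOPE.  Definitions with bodies and unfolding lemmas ([Balaban1985BackgroundPropagators] (3.3) as an object); no estimate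
of the paper; NOT summit progress (cell pub-balaban: NE9 NOT PRINTED / NOT PROVED; spine PROVED 0/9).  Filed by the pub-balaban NE9
BINDER-row owner lineage `b2b-balaban-t4-ne9-p1` (gen 76) as letter (L1′) next to (L1) `B11Eq115Space`; a NEW file, imports
`B9SectCLatticeCarrier` and `B8CurlGradHolonomy` only; nothing of lit-balaban's is modified.  Net new unproved facts: 0.
-/

noncomputable section

namespace Literature.MathematicalPhysics.QuantumFieldTheory.Balaban1983to89.B9Eq33CovDerivVector

open B9SectCLatticeCarrier (Bond bpos btgt sT sJ sD_mulVec shift)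
open B4Sect5Torus (TSite)

variable {d : ℕ} {Pd : Fin d → ℕ} {𝕜 : Type*} [CommRing 𝕜] {V : Type*} [AddCommGroup V] [Module 𝕜 V]

/-! ## §1 (3.3) for fibre-valued site functions, with the transporter as a linear datum -/

/-- **The covariant derivative (3.3) of a fibre-valued function on the sites**, `(D f)(b) = c·(R(b) f(b₊) − f(b₋))` for the bond
`b = ⟨b₋, b₊⟩ = (x, μ)`, `b₊ = x + e_μ`: print's `(D^η_{U₀}A)(b) = η⁻¹(R(U₀(b))A(b₊) − A(b₋))` with `c = η⁻¹` and the transporter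
`R(U₀(b))` an ARBITRARY linear map of the fibre (`R(U)X = UXU⁻¹` on 𝔤-valued functions: `adTransport` below), as a LINEAR MAP in
`f`. [cite: Balaban1985BackgroundPropagators, (3.3) pp.390–391] -/
def covDeriv (c : 𝕜) (R : Bond d Pd → V →ₗ[𝕜] V) : (TSite d Pd → V) →ₗ[𝕜] (Bond d Pd → V) where
  toFun f b := c • (R b (f (btgt b)) - f (bpos b))
  map_add' f g := by
    funext b; simp only [Pi.add_apply, map_add, smul_add, smul_sub]; abel
  map_smul' a f := by
    funext b; simp only [Pi.smul_apply, map_smul, RingHom.id_apply, smul_sub, smul_comm c a]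

/-- Unfolding (3.3). [cite: Balaban1985BackgroundPropagators, (3.3) pp.390–391] -/
theorem covDeriv_apply (c : 𝕜) (R : Bond d Pd → V →ₗ[𝕜] V) (f : TSite d Pd → V) (b : Bond d Pd) :
    covDeriv c R f b = c • (R b (f (btgt b)) - f (bpos b)) := rfl

/-- **The directional derivative** `(D_μ f)(x) = (D f)(⟨x, x + e_μ⟩)` — the second display of (3.3).
[cite: Balaban1985BackgroundPropagators, (3.3) p.391] -/
theorem covDeriv_apply_dir (c : 𝕜) (R : Bond d Pd → V →ₗ[𝕜] V) (f : TSite d Pd → V) (x : TSite d Pd) (μ : Fin d) :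
    covDeriv c R f (x, μ) = c • (R (x, μ) (f (shift μ x)) - f x) := rfl

/-- With the TRIVIAL transporter (`U₀ = 1`, `R = id`) (3.3) is the plain forward difference `c·(f(b₊) − f(b₋))`.
[cite: Balaban1985BackgroundPropagators, (3.3) pp.390–391] -/
theorem covDeriv_apply_flat (c : 𝕜) (f : TSite d Pd → V) (b : Bond d Pd) :
    covDeriv c (fun _ => LinearMap.id) f b = c • (f (btgt b) - f (bpos b)) := rfl

/-- **Consistency with the tree's SCALAR READING** (`B9SectCLatticeCarrier.sD_mulVec`): for real-valued functions and the transporter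
`R(b) = r(b)·id` (a real bond field), (3.3) here IS the matrix `sT c r − sJ c` there applied to `f`.
[cite: Balaban1985BackgroundPropagators, (3.3) pp.390–391] -/
theorem covDeriv_scalar (c : ℝ) (r : Bond d Pd → ℝ) (f : TSite d Pd → ℝ) (b : Bond d Pd) :
    covDeriv c (fun b => r b • (LinearMap.id : ℝ →ₗ[ℝ] ℝ)) f b = (sT c r - sJ c).mulVec f b := by
  rw [sD_mulVec, covDeriv_apply, LinearMap.smul_apply, LinearMap.id_apply, smul_eq_mul, smul_eq_mul]

/-- **Consistency with the tree's ABSTRACT action form** (`B8CurlGradHolonomy.covD s U f x = U x • f (s x) − f x`, η = 1, one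
direction `s`): for a monoid `M` acting on the fibre and the transporter `R(x, μ) = (U(x, μ) • ·)`, (3.3) here at the bond `(x, μ)` is
`c •` that `covD` along the shift `x ↦ x + e_μ`. [cite: Balaban1985BackgroundPropagators, (3.3) pp.390–391] -/
theorem covDeriv_eq_smul_B8covD {M : Type*} [Monoid M] [DistribMulAction M V] [SMulCommClass M 𝕜 V] (c : 𝕜) (U : Bond d Pd → M)
    (f : TSite d Pd → V) (x : TSite d Pd) (μ : Fin d) :
    covDeriv c (fun b => DistribSMul.toLinearMap 𝕜 V (U b)) f (x, μ) =
      c • B8CurlGradHolonomy.covD (shift μ) (fun y => U (y, μ)) f x := by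
  rw [covDeriv_apply_dir, B8CurlGradHolonomy.covD_apply, DistribSMul.toLinearMap_apply]

/-! ## §2 (3.3) on the components of a bond function: `∇_μ A_ν` -/

/-- **The covariant derivatives of a function on the bonds, componentwise**: with the identification `A(x, x + ηe_μ) = A_μ(x)` (p. 391),
`(∇A)((x, μ), ν) = (D_μ A_ν)(x) = c·(R(⟨x, x+e_μ⟩) A_ν(x + e_μ) − A_ν(x))` — (3.3) applied to each component `A_ν`, the object
`∇A′` / `∇A₁` of the sizes `|∇·|_{(−2)}` of [Balaban1985Variational] (77)/(115); as a LINEAR MAP in `A`.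
[cite: Balaban1985BackgroundPropagators, (3.3) p.391] -/
def covGrad (c : 𝕜) (R : Bond d Pd → V →ₗ[𝕜] V) : (Bond d Pd → V) →ₗ[𝕜] (Bond d Pd × Fin d → V) where
  toFun A p := c • (R p.1 (A (btgt p.1, p.2)) - A (bpos p.1, p.2))
  map_add' A B := by
    funext p; simp only [Pi.add_apply, map_add, smul_add, smul_sub]; abel
  map_smul' a A := by
    funext p; simp only [Pi.smul_apply, map_smul, RingHom.id_apply, smul_sub, smul_comm c a]

/-- Unfolding. [cite: Balaban1985BackgroundPropagators, (3.3) p.391] -/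
theorem covGrad_apply (c : 𝕜) (R : Bond d Pd → V →ₗ[𝕜] V) (A : Bond d Pd → V) (b : Bond d Pd) (ν : Fin d) :
    covGrad c R A (b, ν) = c • (R b (A (btgt b, ν)) - A (bpos b, ν)) := rfl

/-- `(∇A)(b, ν)` IS the site-level (3.3) of the component `x ↦ A_ν(x)`. [cite: Balaban1985BackgroundPropagators, (3.3) p.391] -/
theorem covGrad_eq_covDeriv_comp (c : 𝕜) (R : Bond d Pd → V →ₗ[𝕜] V) (A : Bond d Pd → V) (b : Bond d Pd) (ν : Fin d) :
    covGrad c R A (b, ν) = covDeriv c R (fun x => A (x, ν)) b := rfl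

/-- In coordinates: `(∇A)((x, μ), ν) = (D_μ A_ν)(x) = c·(R(x, μ) A_ν(x + e_μ) − A_ν(x))`. [cite: Balaban1985BackgroundPropagators, (3.3) p.391] -/
theorem covGrad_apply_dir (c : 𝕜) (R : Bond d Pd → V →ₗ[𝕜] V) (A : Bond d Pd → V) (x : TSite d Pd) (μ ν : Fin d) :
    covGrad c R A ((x, μ), ν) = c • (R (x, μ) (A (shift μ x, ν)) - A (x, ν)) := rfl

/-! ## §3 The transporter `R(U)X = UXU⁻¹` of a configuration with values in the units of an algebra -/

section Adjoint

variable {𝔸 : Type*} [Ring 𝔸] [Algebra 𝕜 𝔸]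

/-- **`R(U)X = UXU⁻¹`** (p. 390: *«Let us recall that R(U)X = UXU⁻¹»*) for a bond configuration `U` with values in the units of a
`𝕜`-algebra `𝔸` (the gauge group inside `Matrix (Fin N) (Fin N) ℂ`, 𝔤ᶜ ⊆ 𝔸), as a family of LINEAR maps of `𝔸`, bond by bond — the
transporter datum of `covDeriv`/`covGrad` for 𝔤ᶜ-valued functions. [cite: Balaban1985BackgroundPropagators, (3.1)–(3.3) p.390] -/
def adTransport (U : Bond d Pd → 𝔸ˣ) (b : Bond d Pd) : 𝔸 →ₗ[𝕜] 𝔸 :=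
  (LinearMap.mulLeft 𝕜 (U b : 𝔸)).comp (LinearMap.mulRight 𝕜 ((U b)⁻¹ : 𝔸ˣ) )

/-- Unfolding: `R(U(b))X = U(b)·X·U(b)⁻¹`. [cite: Balaban1985BackgroundPropagators, p.390] -/
theorem adTransport_apply (U : Bond d Pd → 𝔸ˣ) (b : Bond d Pd) (X : 𝔸) :
    adTransport (𝕜 := 𝕜) U b X = (U b : 𝔸) * X * ((U b)⁻¹ : 𝔸ˣ) := by
  simp only [adTransport, LinearMap.comp_apply, LinearMap.mulRight_apply, LinearMap.mulLeft_apply, mul_assoc]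

/-- `R(1) = id`: the trivial configuration transports trivially. [cite: Balaban1985BackgroundPropagators, p.390] -/
theorem adTransport_one (b : Bond d Pd) : adTransport (𝕜 := 𝕜) (fun _ : Bond d Pd => (1 : 𝔸ˣ)) b = LinearMap.id := by
  apply LinearMap.ext; intro X
  rw [adTransport_apply, LinearMap.id_apply, Units.val_one, inv_one, Units.val_one, one_mul, mul_one]

/-- `R(U)` is multiplicative: `R(U)(XY) = R(U)X · R(U)Y`. [cite: Balaban1985BackgroundPropagators, p.390] -/
theorem adTransport_mul (U : Bond d Pd → 𝔸ˣ) (b : Bond d Pd) (X Y : 𝔸) :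
    adTransport (𝕜 := 𝕜) U b (X * Y) = adTransport (𝕜 := 𝕜) U b X * adTransport (𝕜 := 𝕜) U b Y := by
  simp only [adTransport_apply, mul_assoc, Units.inv_mul_cancel_left]

/-- `R(U)1 = 1`. [cite: Balaban1985BackgroundPropagators, p.390] -/
theorem adTransport_apply_one (U : Bond d Pd → 𝔸ˣ) (b : Bond d Pd) : adTransport (𝕜 := 𝕜) U b 1 = 1 := by
  rw [adTransport_apply, mul_one, Units.mul_inv]

/-- **(3.3) for 𝔤-valued functions in the background `U₀`**: `(D^η_{U₀} f)(b) = c·(U₀(b) f(b₊) U₀(b)⁻¹ − f(b₋))`.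
[cite: Balaban1985BackgroundPropagators, (3.3) pp.390–391] -/
theorem covDeriv_adTransport_apply (c : 𝕜) (U : Bond d Pd → 𝔸ˣ) (f : TSite d Pd → 𝔸) (b : Bond d Pd) :
    covDeriv c (adTransport (𝕜 := 𝕜) U) f b = c • ((U b : 𝔸) * f (btgt b) * ((U b)⁻¹ : 𝔸ˣ) - f (bpos b)) := by
  rw [covDeriv_apply, adTransport_apply]

/-- **`∇^{U₀}` on bond functions, 𝔤-valued**: `(∇A)((x,μ),ν) = c·(U₀(x,μ) A_ν(x+e_μ) U₀(x,μ)⁻¹ − A_ν(x))`.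
[cite: Balaban1985BackgroundPropagators, (3.3) p.391] -/
theorem covGrad_adTransport_apply (c : 𝕜) (U : Bond d Pd → 𝔸ˣ) (A : Bond d Pd → 𝔸) (b : Bond d Pd) (ν : Fin d) :
    covGrad c (adTransport (𝕜 := 𝕜) U) A (b, ν) = c • ((U b : 𝔸) * A (btgt b, ν) * ((U b)⁻¹ : 𝔸ˣ) - A (bpos b, ν)) := by
  rw [covGrad_apply, adTransport_apply]

end Adjoint

/-! ## §4 (3.8): the adjoint `D*` on bond functions, and its adjointness to (3.3) for the `ℓ²` pairings -/

section Divergence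

open scoped BigOperators InnerProductSpace

/-- The unit step `x ↦ x + e_μ` as a permutation of the periodic lattice (inverse `x ↦ x − e_μ`). [folklore] -/
def shiftEquiv (μ : Fin d) : TSite d Pd ≃ TSite d Pd where
  toFun := shift μ
  invFun := B9SectCLatticeCarrier.unshift μ
  left_inv := B9SectCLatticeCarrier.unshift_shift μ
  right_inv := B9SectCLatticeCarrier.shift_unshift μ

/-- **The adjoint derivative (3.8) on fibre-valued bond functions**, `(D*A)(x) = c·Σ_μ (S(⟨x − e_μ, x⟩) A_μ(x − e_μ) − A_μ(x))` —
print's `(D*A)(x) = Σ_μ η⁻¹(R(U(x, x − ηe_μ))A(x − ηe_μ, x) − A(x, x + ηe_μ))` with `c = η⁻¹` and `S(b) = R(U(b))⁻¹ = R(U(x, x − ηe_μ))`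
(for `b = ⟨x − e_μ, x⟩`) an ARBITRARY linear datum (the adjoint transporters), as a LINEAR MAP in `A`.
[cite: Balaban1985BackgroundPropagators, (3.8) p.392] -/
def covDiv [Fintype (Fin d)] (c : 𝕜) (S : Bond d Pd → V →ₗ[𝕜] V) : (Bond d Pd → V) →ₗ[𝕜] (TSite d Pd → V) where
  toFun A y := c • ∑ μ, (S (B9SectCLatticeCarrier.unshift μ y, μ) (A (B9SectCLatticeCarrier.unshift μ y, μ)) - A (y, μ))
  map_add' A B := by
    funext y
    simp only [Pi.add_apply, map_add, ← smul_add, ← Finset.sum_add_distrib]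
    congr 1
    exact Finset.sum_congr rfl fun μ _ => by abel
  map_smul' a A := by
    funext y
    simp only [Pi.smul_apply, map_smul, RingHom.id_apply, ← smul_sub, ← Finset.smul_sum, smul_comm c a]

/-- Unfolding (3.8). [cite: Balaban1985BackgroundPropagators, (3.8) p.392] -/
theorem covDiv_apply [Fintype (Fin d)] (c : 𝕜) (S : Bond d Pd → V →ₗ[𝕜] V) (A : Bond d Pd → V) (y : TSite d Pd) :
    covDiv c S A y =
      c • ∑ μ, (S (B9SectCLatticeCarrier.unshift μ y, μ) (A (B9SectCLatticeCarrier.unshift μ y, μ)) - A (y, μ)) := rfl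

/-- **Consistency with the tree's SCALAR READING of (3.8)** (`B9SectCLatticeCarrier.sD_transpose_mulVec`: for uniform lattice weights the
adjoint IS the transpose): for `V = ℝ` and `S(b) = r(b)·id`, (3.8) here is the transposed matrix `(sT c r − sJ c)ᵀ` applied to `A`.
[cite: Balaban1985BackgroundPropagators, (3.8) p.392] -/
theorem covDiv_scalar (c : ℝ) (r : Bond d Pd → ℝ) (A : Bond d Pd → ℝ) (y : TSite d Pd) :
    covDiv c (fun b => r b • (LinearMap.id : ℝ →ₗ[ℝ] ℝ)) A y = (sT c r - sJ c).transpose.mulVec A y := by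
  rw [B9SectCLatticeCarrier.sD_transpose_mulVec, covDiv_apply, smul_eq_mul, Finset.mul_sum]
  refine Finset.sum_congr rfl fun μ _ => ?_
  rw [LinearMap.smul_apply, LinearMap.id_apply, smul_eq_mul]
  ring

variable {W : Type*} [NormedAddCommGroup W] [InnerProductSpace ℝ W]

/-- **`D*` IS THE `ℓ²`-ADJOINT OF `D`** (p. 391: *«The adjoints are taken with respect to natural L² scalar products»*): on the periodic
lattice, for real-inner-product fibres and transporter data `R`, `S` that are mutually adjoint on the fibre (`⟪w, R(b)v⟫ = ⟪S(b)w, v⟫` —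
for print's unitary `R(U(b))`, `S(b) = R(U(b))⁻¹`), `Σ_b ⟪A(b), (D f)(b)⟫ = Σ_x ⟪(D*A)(x), f(x)⟫` (uniform lattice weights; the
common factor `η^d` of both pairings is omitted). [cite: Balaban1985BackgroundPropagators, (3.8) p.392] -/
theorem sum_inner_covDeriv_eq_sum_inner_covDiv (c : ℝ) (R S : Bond d Pd → W →ₗ[ℝ] W)
    (hRS : ∀ (b : Bond d Pd) (v w : W), ⟪w, R b v⟫_ℝ = ⟪S b w, v⟫_ℝ) (A : Bond d Pd → W) (f : TSite d Pd → W) :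
    ∑ b, ⟪A b, covDeriv c R f b⟫_ℝ = ∑ y, ⟪covDiv c S A y, f y⟫_ℝ := by
  -- the transported terms are re-indexed along the permutation `x ↦ x + e_μ`, direction by direction
  have key : ∀ μ : Fin d, ∑ x : TSite d Pd, ⟪S (x, μ) (A (x, μ)), f (shift μ x)⟫_ℝ =
      ∑ y : TSite d Pd, ⟪S (B9SectCLatticeCarrier.unshift μ y, μ) (A (B9SectCLatticeCarrier.unshift μ y, μ)), f y⟫_ℝ :=
    fun μ => Fintype.sum_equiv (shiftEquiv μ) _ _ fun x => by
      simp only [shiftEquiv, Equiv.coe_fn_mk, B9SectCLatticeCarrier.unshift_shift]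
  calc ∑ b, ⟪A b, covDeriv c R f b⟫_ℝ
      = ∑ x, ∑ μ, (c * ⟪S (x, μ) (A (x, μ)), f (shift μ x)⟫_ℝ - c * ⟪A (x, μ), f x⟫_ℝ) := by
        rw [Fintype.sum_prod_type]
        refine Finset.sum_congr rfl fun x _ => Finset.sum_congr rfl fun μ _ => ?_
        rw [covDeriv_apply_dir, real_inner_smul_right, inner_sub_right, hRS, mul_sub]
    _ = ∑ μ, ∑ x, (c * ⟪S (x, μ) (A (x, μ)), f (shift μ x)⟫_ℝ - c * ⟪A (x, μ), f x⟫_ℝ) := Finset.sum_comm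
    _ = ∑ μ, ∑ y, (c * ⟪S (B9SectCLatticeCarrier.unshift μ y, μ) (A (B9SectCLatticeCarrier.unshift μ y, μ)), f y⟫_ℝ -
          c * ⟪A (y, μ), f y⟫_ℝ) := by
        refine Finset.sum_congr rfl fun μ _ => ?_
        rw [Finset.sum_sub_distrib, Finset.sum_sub_distrib, ← Finset.mul_sum, ← Finset.mul_sum, key μ, ← Finset.mul_sum]
    _ = ∑ y, ∑ μ, (c * ⟪S (B9SectCLatticeCarrier.unshift μ y, μ) (A (B9SectCLatticeCarrier.unshift μ y, μ)), f y⟫_ℝ -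
          c * ⟪A (y, μ), f y⟫_ℝ) := Finset.sum_comm
    _ = ∑ y, ⟪covDiv c S A y, f y⟫_ℝ := by
        refine Finset.sum_congr rfl fun y _ => ?_
        rw [covDiv_apply, real_inner_smul_left, sum_inner, Finset.mul_sum]
        refine Finset.sum_congr rfl fun μ _ => ?_
        rw [inner_sub_left, mul_sub]

end Divergence

end Literature.MathematicalPhysics.QuantumFieldTheory.Balaban1983to89.B9Eq33CovDerivVector

end
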